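import Summits.BirchSwinnertonDyer.BirchSwinnertonDyer.Theorems.ByReductionTypeAtTwoTowerLayerClasses
import Literature.NumberTheory.EllipticCurves.IwasawaSelmerControlKernelCardProofs
import Literature.NumberTheory.EllipticCurves.Greenberg1999.CyclotomicTorsionFinite
import HarnessLib

/-!
# The finite-layer count WITH rational `p`-torsion: `#Sel_n[p] ≤ #ker h_n · #X/(p,T^{pⁿ})X` and
# `#X/(p,T^{pⁿ})X ≤ #A_n[p]` for every layer `n` (no `E(K)[p] = 0` hypothesis), and the
# torsion-tolerant TOWER-gap door at `p = 2` (route ByReductionTypeAtTwo, items 19573 / 19271 on the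
# 86 INELIG classes; seat bsd-2adic-ord-2 GEN 4)

HONEST FRAMING (cell `bsd-2adic`, run/shared/lean/pub/bsd-2adic/, HUMAN RULINGS D-0036 / D-0054 / D-0074):
THEOREMS ONLY; nothing asserted; no definition; no new named fact; closes nothing by itself.

tower-1's exact count `#X/(p, T^{pⁿ})X = #A_n[p]` (`TowerLayer.natCard_quotient_towerIdeal_eq_natCard_layerClasses`)
and the seat's doors built on it (`TowerClass.towerGapAtTwo_of_layerSelmer_of_layerClasses_counts`, KitC) assume
`p ∤ #E(K)_tors`, because then the restriction `h_n : H¹(K_n, E[p^∞]) → H¹(K_∞, E[p^∞])` is injective. On the 86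
INELIG classes of the X5 good-ordinary census (`E(ℚ)[2] ≠ 0` at every member) it is not. This file keeps the
torsion and pays for it with the ORDER OF `ker h_n`:

* §1 (any number field `K`, any prime `p`, any `ℤ_p`-extension `κ` with topological generator `γ`, any layer `n`;
  `T_n := {s ∈ Sel_{p^∞}(E/K_∞) : p·s = 0, conj_{γ^{pⁿ}} s = s}`, which tower-1's duality counts EXACTLY and
  torsion-free: `#X/I_n X = #T_n`, `TowerLayer.natCard_quotient_layerIdeal_eq`):
  - `natCard_fixedPTorsion_le_natCard_layerClasses_of_finite_ker` — **`#T_n ≤ #A_n[p]`** when `ker h_n` is finite: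
    with `A′ := h_n⁻¹(Sel_∞[p]) ⊇ ker h_n`, `h_n` maps `A′` ONTO `T_n` (Greenberg's Lemma 3.2, tree
    `ZpExtension.mem_range_resOfLe_of_conjH1_eq`) with kernel `ker h_n`, while `y ↦ p·y` maps `A′` into `ker h_n`
    with kernel `A_n[p]`; so `#ker h_n · #T_n = #A′ ≤ #A_n[p] · #ker h_n`;
  - `natCard_selmerLayer_pTorsion_le_mul` — **`#Sel_{p^∞}(E/K_n)[p] ≤ #ker h_n · #T_n`** (`h_n` maps
    `Sel_n[p]` into `T_n` with kernel inside `ker h_n`);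
  - `finite_ker_layerToInfty`, and `#ker h_n = #E[p^∞]^{Gal(K̄/K_n)}` is the tree's
    `natCard_ker_layerToInfty_eq_natCard_fixedPoints` (Greenberg, proof of Lemma 4.3), both under the
    finiteness of `B = E(K_∞)[p^∞]`.
* §2 (`K = ℚ`, `p = 2`): **`TowerClass.towerGapAtTwo_of_counts_of_torsion`** — `O1.TowerGapAtTwo W` from a
  STRICT lower count `2^a ≤ #Sel_{2^∞}(E/ℚ_j)[2]`, an EXACT upper count `#A_{j'}[2] ≤ 2^d`, a TORSION count
  `#E[2^∞]^{Gal(ℚ̄/ℚ_j)} ≤ 2^t` and the linear certificate `d + t + 1 ≤ 2^{j'} − 2^j + a`, granted the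
  finiteness of `E(ℚ_∞)[2^∞]` — displayed per `W` (`…_of_counts_of_torsion`) or as the PRINT named fact
  `Greenberg1999.finite_torsion_cyclotomicZpExtension` (Greenberg LNM 1716 §1 / Imai / Ribet;
  `…_of_counts_of_torsion_print`). With `t = 0` this is KitC's door again (no torsion hypothesis needed
  either way). The doors AT `W` (Kato half = items 19271/19573 at `W`, `MissingUpperBoundAt`, `BSD₂`,
  `2`-adic IMC) are KitB's `…_of_towerGap_of_abbesUllmo`, unchanged.

Habitat note (evidence tier, tower-eng TABLE-TOWER-E1 @16f1b5fa230aec58, conservative reading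
`#A_{j'}[2] = 2^{ehi_{j'} − t_{j'}}`, `t = v₂(#E(ℚ)_tors)`): 10 of the 86 INELIG classes satisfy the
certificate at `(j, j') = (0, 2)` today (all `λ_an = 2`). Nothing here is a class theorem about every `W`.

References: [GreenbergLNM1716] §1 p. 60 and p. 62, §3 pp. 85–86 (Lemmas 3.1, 3.2), §4 Lemma 4.3 (p. 103);
[Washington1997] §13.2; [Ribet1981KatzLangAppendix].
-/

set_option autoImplicit false
-- the route's Theorems namespace repeats a component by design (summit = sub-problem, D-0017).
set_option linter.dupNamespace false

noncomputable section

open scoped Classical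

open WeierstrassCurve Literature.NumberTheory.EllipticCurves PowerSeries
  Summit.BirchSwinnertonDyer.Rank1Residual Summit.BirchSwinnertonDyer.Rank1Residual.X5.TowerGap

universe u

namespace Summit.BirchSwinnertonDyer.BirchSwinnertonDyer.Theorems.TowerLayer

/-! ## §1 The layer counts with `ker h_n` -/

section Layer

variable {K : Type u} [Field K] [NumberField K] (W : WeierstrassCurve K) [W.IsElliptic] {p : ℕ}
  [hp : Fact p.Prime] (κ : ZpExtension K p) {γ : Field.absoluteGaloisGroup K}

/-- For an additive hom `f : G → G'`: `#G = #ker f · #range f` (`Nat.card`, no finiteness). [folklore] -/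
theorem natCard_eq_natCard_ker_mul_natCard_range {G G' : Type*} [AddGroup G] [AddGroup G']
    (f : G →+ G') : Nat.card G = Nat.card f.ker * Nat.card f.range := by
  rw [← AddSubgroup.index_ker, AddSubgroup.card_mul_index]

omit [W.IsElliptic] in
/-- The image of `h_n` consists of classes fixed by `conj_{γ^{pⁿ}}` (`γ^{pⁿ} ∈ Gal(K̄/K_n)`, tree
`range_layerToInfty_le_layerInvariants_holds`). [cite: GreenbergLNM1716, §3 p. 86] -/
theorem conjH1_pow_layerToInfty (γ : Field.absoluteGaloisGroup K) (n : ℕ)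
    (y : W.subgroupH1 p (κ.layerSubgroup n)) :
    W.conjH1 p κ.kerSubgroup (γ ^ p ^ n) (W.layerToInfty κ n y) = W.layerToInfty κ n y := by
  have hmem : W.layerToInfty κ n y ∈ W.layerInvariants κ n :=
    W.range_layerToInfty_le_layerInvariants_holds κ n ⟨_, rfl⟩
  rw [mem_layerInvariants_iff] at hmem
  exact hmem _ (X1.GeneratorCountLayer.pow_mem_layerSubgroup κ γ n)

omit [W.IsElliptic] in
/-- A `p`-primary class of `H¹(K_∞, E[p^∞])` fixed by `conj_{γ^{pⁿ}}` (`γ` a topological generator) is a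
restriction from `K_n` — Greenberg's Lemma 3.2 in the tree's sharp form
`ZpExtension.mem_range_resOfLe_of_conjH1_eq`. [cite: GreenbergLNM1716, §3 Lemma 3.2] -/
theorem mem_range_layerToInfty_of_conjH1_eq (hγ : κ.IsTopGenerator γ) (n : ℕ)
    (s : W.subgroupH1 p κ.kerSubgroup) (hfix : W.conjH1 p κ.kerSubgroup (γ ^ p ^ n) s = s) :
    s ∈ (W.layerToInfty κ n).range := by
  have hprim : ∀ m : geomPrimaryTorsion W p, ∃ k : ℕ, p ^ k • m = 0 := fun m ↦ by
    obtain ⟨k, hk⟩ := m.2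
    exact ⟨k, Subtype.ext (by rw [AddSubgroupClass.coe_nsmul, hk, ZeroMemClass.coe_zero])⟩
  exact ZpExtension.mem_range_resOfLe_of_conjH1_eq κ hγ n (W.continuous_smul_geomPrimaryTorsion p) hprim s hfix

omit [W.IsElliptic] in
/-- **`#T_n ≤ #A_n[p]` with rational torsion allowed** (`T_n = Sel_∞[p]^{γ^{pⁿ}}`, `A_n = h_n⁻¹(Sel_∞)`,
`γ` a topological generator, `ker h_n` finite). With `A′ = h_n⁻¹(Sel_∞[p])`: `h_n : A′ ↠ T_n` has kernel
`ker h_n` (`#A′ = #ker h_n · #T_n`) and `y ↦ p·y : A′ → ker h_n` has kernel `A_n[p]`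
(`#A′ ≤ #A_n[p] · #ker h_n`). [cite: GreenbergLNM1716, §3 pp. 85–86 (Lemmas 3.1, 3.2)] -/
theorem natCard_fixedPTorsion_le_natCard_layerClasses_of_finite_ker (hγ : κ.IsTopGenerator γ) (n : ℕ)
    (hfin : Finite (W.layerToInfty κ n).ker) :
    Nat.card {s : W.selmerInfty κ // p • s = 0 ∧
        W.conjH1 p κ.kerSubgroup (γ ^ p ^ n) (s : W.subgroupH1 p κ.kerSubgroup) = s} ≤
      Nat.card {z : W.selmerInftyPreimage κ n // p • z = 0} := by
  -- abbreviations
  set L := W.subgroupH1 p (κ.layerSubgroup n) with hL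
  set h := W.layerToInfty κ n with hh
  -- `Sel_∞[p]` as a subgroup and `A′ = h⁻¹(Sel_∞[p])`
  let Sp : AddSubgroup (W.subgroupH1 p κ.kerSubgroup) :=
    W.selmerInfty κ ⊓ (DistribSMul.toAddMonoidHom (W.subgroupH1 p κ.kerSubgroup) p).ker
  have hSp : ∀ s, s ∈ Sp ↔ s ∈ W.selmerInfty κ ∧ p • s = 0 := fun s ↦ by
    simp only [Sp, AddSubgroup.mem_inf, AddMonoidHom.mem_ker, DistribSMul.toAddMonoidHom_apply]
  let A' : AddSubgroup L := Sp.comap h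
  have hA' : ∀ y : L, y ∈ A' ↔ h y ∈ W.selmerInfty κ ∧ p • h y = 0 := fun y ↦ by
    rw [AddSubgroup.mem_comap, hSp]
  have hkerA' : h.ker ≤ A' := fun y hy ↦ by
    rw [hA', (AddMonoidHom.mem_ker).mp hy]; exact ⟨zero_mem _, smul_zero _⟩
  -- (1) `h` on `A′`: kernel `≃ ker h`, range `≃ T_n`
  let h' : A' →+ W.subgroupH1 p κ.kerSubgroup := h.comp A'.subtype
  have hker' : Nat.card h'.ker = Nat.card h.ker := by
    have e1 : h'.ker = h.ker.addSubgroupOf A' := by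
      ext y
      simp only [h', AddMonoidHom.mem_ker, AddMonoidHom.coe_comp, AddSubgroup.coe_subtype,
        Function.comp_apply, AddSubgroup.mem_addSubgroupOf]
    rw [e1]
    exact Nat.card_congr (AddSubgroup.addSubgroupOfEquivOfLe hkerA').toEquiv
  have hrange' : Nat.card h'.range = Nat.card {s : W.selmerInfty κ // p • s = 0 ∧
      W.conjH1 p κ.kerSubgroup (γ ^ p ^ n) (s : W.subgroupH1 p κ.kerSubgroup) = s} := by
    let g : h'.range → {s : W.selmerInfty κ // p • s = 0 ∧
        W.conjH1 p κ.kerSubgroup (γ ^ p ^ n) (s : W.subgroupH1 p κ.kerSubgroup) = s} := fun x ↦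
      ⟨⟨x.1, by
          obtain ⟨y, hy⟩ := x.2
          have := ((hA' y).mp y.2).1
          rw [← hy]; exact this⟩, by
          obtain ⟨y, hy⟩ := x.2
          refine ⟨Subtype.ext ?_, ?_⟩
          · rw [AddSubgroup.coe_nsmul, AddSubgroup.coe_mk, ← hy]
            exact ((hA' y).mp y.2).2
          · rw [AddSubgroup.coe_mk, ← hy]
            exact conjH1_pow_layerToInfty W κ γ n y⟩
    refine Nat.card_congr (Equiv.ofBijective g ⟨?_, ?_⟩)
    · intro x x' hxx'
      have := congrArg (fun s ↦ ((s.1 : W.selmerInfty κ) : W.subgroupH1 p κ.kerSubgroup)) hxx'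
      exact Subtype.ext this
    · rintro ⟨s, hps, hfix⟩
      obtain ⟨y, hy⟩ := mem_range_layerToInfty_of_conjH1_eq W κ hγ n _ hfix
      have hyA : y ∈ A' := by
        rw [hA', hh, hy]
        exact ⟨s.2, by rw [← AddSubgroup.coe_nsmul, hps, AddSubgroup.coe_zero]⟩
      refine ⟨⟨h y, ⟨⟨y, hyA⟩, rfl⟩⟩, Subtype.ext (Subtype.ext ?_)⟩
      exact hy
  have hcount₁ : Nat.card A' = Nat.card h.ker * Nat.card {s : W.selmerInfty κ // p • s = 0 ∧
      W.conjH1 p κ.kerSubgroup (γ ^ p ^ n) (s : W.subgroupH1 p κ.kerSubgroup) = s} := by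
    rw [← hker', ← hrange']; exact natCard_eq_natCard_ker_mul_natCard_range h'
  -- (2) `y ↦ p·y` on `A′`: kernel `≃ A_n[p]`, range inside `ker h`
  let m : A' →+ L := (DistribSMul.toAddMonoidHom L p).comp A'.subtype
  have hmker : Nat.card m.ker = Nat.card {z : W.selmerInftyPreimage κ n // p • z = 0} := by
    let g : m.ker → {z : W.selmerInftyPreimage κ n // p • z = 0} := fun y ↦
      ⟨⟨(y.1 : L), by
          rw [mem_selmerInftyPreimage_iff]; exact ((hA' _).mp y.1.2).1⟩, by
          apply Subtype.ext
          have := (AddMonoidHom.mem_ker).mp y.2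
          simpa [m] using this⟩
    refine Nat.card_congr (Equiv.ofBijective g ⟨?_, ?_⟩)
    · intro y y' hyy'
      have := congrArg (fun z ↦ ((z.1 : W.selmerInftyPreimage κ n) : L)) hyy'
      exact Subtype.ext (Subtype.ext this)
    · rintro ⟨z, hz⟩
      have hz' : p • (z : L) = 0 := by
        rw [← AddSubgroup.coe_nsmul, hz, AddSubgroup.coe_zero]
      have hzA : (z : L) ∈ A' := by
        rw [hA']
        refine ⟨(mem_selmerInftyPreimage_iff W κ n _).mp z.2, ?_⟩
        rw [← map_nsmul, hz', map_zero]
      refine ⟨⟨⟨(z : L), hzA⟩, ?_⟩, Subtype.ext (Subtype.ext rfl)⟩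
      rw [AddMonoidHom.mem_ker]
      simpa [m] using hz'
  have hmrange : Nat.card m.range ≤ Nat.card h.ker := by
    have hle : m.range ≤ h.ker := by
      rintro _ ⟨y, rfl⟩
      rw [AddMonoidHom.mem_ker]
      change h (p • (y : L)) = 0
      rw [map_nsmul]
      exact ((hA' _).mp y.2).2
    haveI := hfin
    exact Nat.card_le_card_of_injective _ (AddSubgroup.inclusion_injective hle)
  have hcount₂ : Nat.card A' ≤ Nat.card {z : W.selmerInftyPreimage κ n // p • z = 0} * Nat.card h.ker := by
    rw [natCard_eq_natCard_ker_mul_natCard_range m, hmker]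
    exact Nat.mul_le_mul_left _ hmrange
  -- (3) cancel `#ker h ≥ 1`
  haveI := hfin
  have hpos : 0 < Nat.card h.ker := Nat.card_pos
  rw [hcount₁] at hcount₂
  rw [mul_comm] at hcount₂
  exact Nat.le_of_mul_le_mul_right hcount₂ hpos

omit [W.IsElliptic] in
/-- **`#Sel_{p^∞}(E/K_n)[p] ≤ #ker h_n · #T_n`**: `h_n` carries `Sel_n[p]` into `T_n = Sel_∞[p]^{γ^{pⁿ}}`
(`selmerLayer_le_selmerInftyPreimage`, `range_layerToInfty_le_layerInvariants_holds`) with kernel inside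
`ker h_n`. [cite: GreenbergLNM1716, §1 Thm. 1.2 and §3 pp. 85–86] -/
theorem natCard_selmerLayer_pTorsion_le_mul (γ : Field.absoluteGaloisGroup K) (n : ℕ)
    (hfin : Finite (W.layerToInfty κ n).ker)
    (hT : Finite {s : W.selmerInfty κ // p • s = 0 ∧
      W.conjH1 p κ.kerSubgroup (γ ^ p ^ n) (s : W.subgroupH1 p κ.kerSubgroup) = s}) :
    Nat.card {z : W.selmerLayer κ n // p • z = 0} ≤
      Nat.card (W.layerToInfty κ n).ker * Nat.card {s : W.selmerInfty κ // p • s = 0 ∧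
        W.conjH1 p κ.kerSubgroup (γ ^ p ^ n) (s : W.subgroupH1 p κ.kerSubgroup) = s} := by
  set L := W.subgroupH1 p (κ.layerSubgroup n) with hL
  set h := W.layerToInfty κ n with hh
  let S : AddSubgroup L := W.selmerLayer κ n ⊓ (DistribSMul.toAddMonoidHom L p).ker
  have hS : ∀ y : L, y ∈ S ↔ y ∈ W.selmerLayer κ n ∧ p • y = 0 := fun y ↦ by
    simp only [S, AddSubgroup.mem_inf, AddMonoidHom.mem_ker, DistribSMul.toAddMonoidHom_apply]
  have hSel : Nat.card {z : W.selmerLayer κ n // p • z = 0} = Nat.card S := by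
    let g : {z : W.selmerLayer κ n // p • z = 0} → S := fun z ↦ ⟨(z.1 : L), (hS _).mpr ⟨z.1.2, by
      rw [← AddSubgroup.coe_nsmul, z.2, AddSubgroup.coe_zero]⟩⟩
    refine Nat.card_congr (Equiv.ofBijective g ⟨?_, ?_⟩)
    · intro z z' hzz'
      have := congrArg (fun w : S ↦ (w : L)) hzz'
      exact Subtype.ext (Subtype.ext this)
    · rintro ⟨y, hy⟩
      obtain ⟨hy1, hy2⟩ := (hS y).mp hy
      exact ⟨⟨⟨y, hy1⟩, Subtype.ext (by rw [AddSubgroup.coe_nsmul, AddSubgroup.coe_zero]; exact hy2)⟩, rfl⟩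
  let ψ : S →+ W.subgroupH1 p κ.kerSubgroup := h.comp S.subtype
  -- kernel inside `ker h`
  have hψker : Nat.card ψ.ker ≤ Nat.card h.ker := by
    haveI := hfin
    refine Nat.card_le_card_of_injective (fun y : ψ.ker ↦ (⟨(y.1 : L), ?_⟩ : h.ker)) ?_
    · have := (AddMonoidHom.mem_ker).mp y.2
      rw [AddMonoidHom.mem_ker]
      simpa [ψ] using this
    · intro y y' hyy'
      have := congrArg (fun w : h.ker ↦ (w : L)) hyy'
      exact Subtype.ext (Subtype.ext this)
  -- range inside `T_n`
  have hψrange : Nat.card ψ.range ≤ Nat.card {s : W.selmerInfty κ // p • s = 0 ∧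
      W.conjH1 p κ.kerSubgroup (γ ^ p ^ n) (s : W.subgroupH1 p κ.kerSubgroup) = s} := by
    haveI := hT
    refine Nat.card_le_card_of_injective (fun x : ψ.range ↦ (⟨⟨x.1, ?_⟩, ?_, ?_⟩ : {s : W.selmerInfty κ //
      p • s = 0 ∧ W.conjH1 p κ.kerSubgroup (γ ^ p ^ n) (s : W.subgroupH1 p κ.kerSubgroup) = s})) ?_
    · obtain ⟨y, hy⟩ := x.2
      rw [← hy]
      exact (mem_selmerInftyPreimage_iff W κ n _).mp
        (W.selmerLayer_le_selmerInftyPreimage κ n ((hS _).mp y.2).1)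
    · obtain ⟨y, hy⟩ := x.2
      apply Subtype.ext
      rw [AddSubgroup.coe_nsmul, AddSubgroup.coe_mk, ← hy]
      change p • h (y : L) = 0
      rw [← map_nsmul, ((hS _).mp y.2).2, map_zero]
    · obtain ⟨y, hy⟩ := x.2
      rw [AddSubgroup.coe_mk, ← hy]
      exact conjH1_pow_layerToInfty W κ γ n (y : L)
    · intro x x' hxx'
      have := congrArg (fun s : {s : W.selmerInfty κ // p • s = 0 ∧
        W.conjH1 p κ.kerSubgroup (γ ^ p ^ n) (s : W.subgroupH1 p κ.kerSubgroup) = s} ↦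
          ((s.1 : W.selmerInfty κ) : W.subgroupH1 p κ.kerSubgroup)) hxx'
      exact Subtype.ext this
  rw [hSel, natCard_eq_natCard_ker_mul_natCard_range ψ]
  exact Nat.mul_le_mul hψker hψrange

omit [W.IsElliptic] in
/-- **`ker h_n` is finite when `B = E(K_∞)[p^∞]` is finite** — `#ker h_n = #E[p^∞]^{Gal(K̄/K_n)}`
(tree `natCard_ker_layerToInfty_eq_natCard_fixedPoints`, Greenberg's proof of Lemma 4.3) and the right side is
a non-empty subset of `B`. [cite: GreenbergLNM1716, §4 Lemma 4.3 (p. 103)] -/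
theorem finite_ker_layerToInfty (n : ℕ)
    [Finite (FixedPoints.addSubgroup κ.kerSubgroup (geomPrimaryTorsion W p))] :
    Finite (W.layerToInfty κ n).ker := by
  apply Nat.finite_of_card_ne_zero
  rw [W.natCard_ker_layerToInfty_eq_natCard_fixedPoints κ n]
  haveI : Finite {m : geomPrimaryTorsion W p | ∀ σ ∈ κ.layerSubgroup n, σ • m = m} := by
    refine Finite.of_injective (fun m : {m : geomPrimaryTorsion W p | ∀ σ ∈ κ.layerSubgroup n, σ • m = m} ↦
      (⟨m.1, ?_⟩ : FixedPoints.addSubgroup κ.kerSubgroup (geomPrimaryTorsion W p))) ?_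
    · rw [FixedPoints.mem_addSubgroup]
      rintro ⟨τ, hτ⟩
      rw [Subgroup.mk_smul]
      exact m.2 τ (κ.kerSubgroup_le_layerSubgroup n hτ)
    · intro a b hab
      exact Subtype.ext (congrArg (fun x : FixedPoints.addSubgroup κ.kerSubgroup (geomPrimaryTorsion W p) ↦
        (x : geomPrimaryTorsion W p)) hab)
  haveI : Nonempty {m : geomPrimaryTorsion W p | ∀ σ ∈ κ.layerSubgroup n, σ • m = m} :=
    ⟨⟨0, fun σ _ ↦ smul_zero σ⟩⟩
  exact Nat.card_pos.ne'

end Layer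

end Summit.BirchSwinnertonDyer.BirchSwinnertonDyer.Theorems.TowerLayer

/-! ## §2 The torsion-tolerant TOWER-gap door at `p = 2` -/

namespace Summit.BirchSwinnertonDyer.BirchSwinnertonDyer.Theorems.TowerClass

open Summit.BirchSwinnertonDyer.Rank1Residual.X5.O1 Summit.BirchSwinnertonDyer.BirchSwinnertonDyer.Theorems

variable (W : WeierstrassCurve ℚ) [W.IsElliptic]

/-- **Tower gap with rational `2`-torsion allowed.** For an elliptic curve `E/ℚ` (no torsion hypothesis),
granted the finiteness of `E(ℚ_∞)[2^∞]` for the cyclotomic `ℤ₂`-extension (`hB`): a STRICT lower count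
`2^a ≤ #Sel_{2^∞}(E/ℚ_j)[2]`, a TORSION count `#E[2^∞]^{Gal(ℚ̄/ℚ_j)} ≤ 2^t`, an EXACT upper count
`#A_{j'}[2] ≤ 2^d` (`A_{j'} = h_{j'}⁻¹(Sel_{2^∞}(E/ℚ_∞))`) and `d + t + 1 ≤ 2^{j'} − 2^j + a` give
`O1.TowerGapAtTwo W`: `#X/(2,T^{2^{j'}})X = #T_{j'} ≤ #A_{j'}[2] ≤ 2^d < 2^{2^{j'}−2^j}·2^{a−t} ≤
2^{2^{j'}−2^j}·#T_j = 2^{2^{j'}−2^j}·#X/(2,T^{2^j})X` (`#Sel_j[2] ≤ #ker h_j · #T_j`, `#ker h_j = #E[2^∞]^{Gal(ℚ̄/ℚ_j)}`).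
With `t = 0` this is KitC's `towerGapAtTwo_of_layerSelmer_of_layerClasses_counts`.
[cite: GreenbergLNM1716, §1 p. 60, §3 pp. 85–86, §4 Lemma 4.3] [cite: Washington1997, §13.2] -/
theorem towerGapAtTwo_of_counts_of_torsion
    (hB : ∀ κ : ZpExtension ℚ 2, κ.IsCyclotomic →
      Finite (FixedPoints.addSubgroup κ.kerSubgroup (geomPrimaryTorsion W 2)))
    {j j' a d t : ℕ} (hjj' : j ≤ j')
    (hlow : ∀ κ : ZpExtension ℚ 2, κ.IsCyclotomic →
      2 ^ a ≤ Nat.card {z : W.selmerLayer κ j // 2 • z = 0})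
    (htor : ∀ κ : ZpExtension ℚ 2, κ.IsCyclotomic →
      Nat.card {m : geomPrimaryTorsion W 2 | ∀ σ ∈ κ.layerSubgroup j, σ • m = m} ≤ 2 ^ t)
    (hup : ∀ κ : ZpExtension ℚ 2, κ.IsCyclotomic →
      Nat.card {z : W.selmerInftyPreimage κ j' // 2 • z = 0} ≤ 2 ^ d)
    (had : d + t + 1 ≤ 2 ^ j' - 2 ^ j + a) : TowerGapAtTwo W := by
  intro κ γ hκ hγ _ D
  haveI : Module.Finite (IwasawaAlgebra 2) D.X := D.module_finite_holds hγ
  haveI := hB κ hκ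
  have hfinj : Finite (W.layerToInfty κ j).ker := TowerLayer.finite_ker_layerToInfty W κ j
  have hfinj' : Finite (W.layerToInfty κ j').ker := TowerLayer.finite_ker_layerToInfty W κ j'
  have hTj : Finite {s : W.selmerInfty κ // 2 • s = 0 ∧
      W.conjH1 2 κ.kerSubgroup (γ ^ 2 ^ j) (s : W.subgroupH1 2 κ.kerSubgroup) = s} :=
    TowerLayer.finite_fixedPTorsion D j
  refine ⟨2 ^ j, 2 ^ j' - 2 ^ j, ?_⟩
  rw [Nat.add_sub_cancel' (Nat.pow_le_pow_right (by norm_num) hjj')]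
  have ej' : Nat.card (D.X ⧸ (towerIdeal 2 (2 ^ j') • ⊤ : Submodule (IwasawaAlgebra 2) D.X)) =
      Nat.card {s : W.selmerInfty κ // 2 • s = 0 ∧
        W.conjH1 2 κ.kerSubgroup (γ ^ 2 ^ j') (s : W.subgroupH1 2 κ.kerSubgroup) = s} := by
    rw [← KatoHalfPinch.layerIdeal_eq_towerIdeal, TowerLayer.natCard_quotient_layerIdeal_eq D j']
  have ej : Nat.card (D.X ⧸ (towerIdeal 2 (2 ^ j) • ⊤ : Submodule (IwasawaAlgebra 2) D.X)) =
      Nat.card {s : W.selmerInfty κ // 2 • s = 0 ∧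
        W.conjH1 2 κ.kerSubgroup (γ ^ 2 ^ j) (s : W.subgroupH1 2 κ.kerSubgroup) = s} := by
    rw [← KatoHalfPinch.layerIdeal_eq_towerIdeal, TowerLayer.natCard_quotient_layerIdeal_eq D j]
  have hK : Nat.card (W.layerToInfty κ j).ker ≤ 2 ^ t := by
    rw [W.natCard_ker_layerToInfty_eq_natCard_fixedPoints κ j]; exact htor κ hκ
  have h1 : 2 ^ a ≤ 2 ^ t * Nat.card {s : W.selmerInfty κ // 2 • s = 0 ∧
      W.conjH1 2 κ.kerSubgroup (γ ^ 2 ^ j) (s : W.subgroupH1 2 κ.kerSubgroup) = s} :=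
    (hlow κ hκ).trans ((TowerLayer.natCard_selmerLayer_pTorsion_le_mul W κ γ j hfinj hTj).trans
      (Nat.mul_le_mul_right _ hK))
  rw [ej', ej]
  have key : 2 ^ t * 2 ^ d < 2 ^ t * (2 ^ (2 ^ j' - 2 ^ j) * Nat.card {s : W.selmerInfty κ // 2 • s = 0 ∧
      W.conjH1 2 κ.kerSubgroup (γ ^ 2 ^ j) (s : W.subgroupH1 2 κ.kerSubgroup) = s}) :=
    calc 2 ^ t * 2 ^ d = 2 ^ (t + d) := (pow_add _ _ _).symm
      _ < 2 ^ (2 ^ j' - 2 ^ j + a) := Nat.pow_lt_pow_right (by norm_num) (by omega)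
      _ = 2 ^ (2 ^ j' - 2 ^ j) * 2 ^ a := pow_add _ _ _
      _ ≤ 2 ^ (2 ^ j' - 2 ^ j) * (2 ^ t * Nat.card {s : W.selmerInfty κ // 2 • s = 0 ∧
          W.conjH1 2 κ.kerSubgroup (γ ^ 2 ^ j) (s : W.subgroupH1 2 κ.kerSubgroup) = s}) :=
        Nat.mul_le_mul_left _ h1
      _ = 2 ^ t * (2 ^ (2 ^ j' - 2 ^ j) * Nat.card {s : W.selmerInfty κ // 2 • s = 0 ∧
          W.conjH1 2 κ.kerSubgroup (γ ^ 2 ^ j) (s : W.subgroupH1 2 κ.kerSubgroup) = s}) := by ring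
  calc Nat.card {s : W.selmerInfty κ // 2 • s = 0 ∧
        W.conjH1 2 κ.kerSubgroup (γ ^ 2 ^ j') (s : W.subgroupH1 2 κ.kerSubgroup) = s}
      ≤ Nat.card {z : W.selmerInftyPreimage κ j' // 2 • z = 0} :=
        TowerLayer.natCard_fixedPTorsion_le_natCard_layerClasses_of_finite_ker W κ hγ j' hfinj'
    _ ≤ 2 ^ d := hup κ hκ
    _ < _ := Nat.lt_of_mul_lt_mul_left key

/-- **The same door with the finiteness of `E(ℚ_∞)[2^∞]` taken from PRINT**: Greenberg, LNM 1716 §1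
(paragraph after (1.8): "`E(F_∞)_tors` is finite", Mazur Prop. 6.12 / Imai / Ribet), the tree's named fact
`Greenberg1999.finite_torsion_cyclotomicZpExtension` (binder `hB`). [cite: GreenbergLNM1716, §1 p. 62]
[cite: Ribet1981KatzLangAppendix, Theorem (p. 315)] -/
theorem towerGapAtTwo_of_counts_of_torsion_print
    (hB : Greenberg1999.finite_torsion_cyclotomicZpExtension)
    {j j' a d t : ℕ} (hjj' : j ≤ j')
    (hlow : ∀ κ : ZpExtension ℚ 2, κ.IsCyclotomic →
      2 ^ a ≤ Nat.card {z : W.selmerLayer κ j // 2 • z = 0})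
    (htor : ∀ κ : ZpExtension ℚ 2, κ.IsCyclotomic →
      Nat.card {m : geomPrimaryTorsion W 2 | ∀ σ ∈ κ.layerSubgroup j, σ • m = m} ≤ 2 ^ t)
    (hup : ∀ κ : ZpExtension ℚ 2, κ.IsCyclotomic →
      Nat.card {z : W.selmerInftyPreimage κ j' // 2 • z = 0} ≤ 2 ^ d)
    (had : d + t + 1 ≤ 2 ^ j' - 2 ^ j + a) : TowerGapAtTwo W :=
  towerGapAtTwo_of_counts_of_torsion W (fun κ hκ ↦ hB W 2 κ hκ) hjj' hlow htor hup had

/-- **The layer-`0` form** (`ℚ` lower, `ℚ_{j'}` upper): the torsion count is `#E[2^∞]^{Γ_ℚ} ≤ 2^t`, the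
number of `2`-power torsion points of `E(ℚ̄)` fixed by `Γ_ℚ` (`= #E(ℚ)[2^∞]` by Galois descent;
tree `natCard_fixedBy_layerSubgroup_zero_eq`). [cite: GreenbergLNM1716, §1 p. 60, §3 pp. 85–86, §4 Lemma 4.3] -/
theorem towerGapAtTwo_of_counts_of_torsion_zero
    (hB : Greenberg1999.finite_torsion_cyclotomicZpExtension)
    {j' a d t : ℕ}
    (hlow : ∀ κ : ZpExtension ℚ 2, κ.IsCyclotomic →
      2 ^ a ≤ Nat.card {z : W.selmerLayer κ 0 // 2 • z = 0})
    (htor : Nat.card (MulAction.fixedPoints (Field.absoluteGaloisGroup ℚ) (geomPrimaryTorsion W 2)) ≤ 2 ^ t)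
    (hup : ∀ κ : ZpExtension ℚ 2, κ.IsCyclotomic →
      Nat.card {z : W.selmerInftyPreimage κ j' // 2 • z = 0} ≤ 2 ^ d)
    (had : d + t + 1 ≤ 2 ^ j' - 1 + a) : TowerGapAtTwo W :=
  towerGapAtTwo_of_counts_of_torsion_print W hB (Nat.zero_le j') hlow
    (fun κ _ ↦ by rw [W.natCard_fixedBy_layerSubgroup_zero_eq κ]; exact htor) hup
    (by simpa using had)

end Summit.BirchSwinnertonDyer.BirchSwinnertonDyer.Theorems.TowerClass

end
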